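import Summits.QuantumFields.BalabanUV.T4Continuum.Support.AveragingDeficitBlockDensity
import Summits.QuantumFields.BalabanUV.T4Continuum.Support.BlockAverageDbarLinNorms
import Summits.QuantumFields.BalabanUV.T4Continuum.Support.BlockAverageLoopFlux
import HarnessLib

/-!
# AveragingDeficitBlockDensitySeg (T⁴ programme, node NE3, row NE3-R2, gen 6) — THE TRANSPORTED STRAIGHT SEGMENTS OF THE BLOCK
# DENSITY: `segMain L U (S₀φ) (L•y) κ = ((L+1)/2L)·Ad_{U(Γ_c)}φ(y,κ) + ((L−1)/2L)·Ad_{U(Γ_c)U(Γ_{c′})}φ(y+e_κ,κ) + O(a)·(‖φ(y,κ)‖ + ‖φ(y+e_κ,κ)‖)`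
# (file 5 of (γ2), the gradient-bounded one-step lift — record `t4/T4-EST-NE3-R2.md` v0.6 §4)

HONEST FRAMING (cell `pub-balaban`, T4-DAG PAGE 1; unit `b2b-balaban-t4-ne3r2-p1` = owner of BINDER-OWNERS row NE3-R2, gen 6).
The cell's T4 target is the finite-torus continuum limit of the unit-scale averaged loop expectations — NOT infinite volume, NO
mass gap, NOT Clay, NOT summit progress.  WHY.  By leaf-10's `BlockAverageDbarLinBound.norm_dbarLin_sub_main_le` the non-gauge part
of the linearised average (42) is `Ad_{V̄(c)⁻¹} segMain + O(w)`, `segMain L W Y c = Σ_{x∈B(c₋)} L^{−d} Ad_{W(Γ_{c₋,x})}(δ_Y W)([x, x+Le_κ])`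
(the block average of the TRANSPORTED straight segments).  THIS FILE evaluates it on the block density `Y = S₀φ = blockDensity L U φ`
(file 2): the straight segment from `x = Ly + r` runs `L − r_κ` bonds in the block of `y` (each carrying `L⁻¹φ(y,κ)` up to a closed-word
holonomy of length `≤ (2d+1)L`) and `r_κ` bonds in the block of `y + e_κ` (each carrying `L⁻¹φ(y+e_κ,κ)`, reached through a closed word of
length `≤ 2(d+1)L` around `Γ_c`); the first moments `Σ_r L^{−d}(L − r_κ) = L(L+1)/2L… ` give the weights `(L+1)/2L`, `(L−1)/2L`.  All
[folklore], 0 sorry: §1 `dhol_seg_eq_sum` (the linearised transport along a positive straight segment as a sum), `l1_le_of_bounds`;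
§2 the in-block segment loop `loopWordC` and the face loop `loopWordK` (hol identities, `‖U(loop) − 1‖ ≤ |loop|²a` by file 2's uniform
loop lemma); §3 **`norm_seg_blockDensity_sub_le`**: inside the block of `y`, `‖Ad_{U(Γ_{Ly,p})}(δ_{S₀φ}U)([p,p+me_κ]) − (m/L)·Ad_{U(Γ_c)}φ(y,κ)‖
≤ (m/L)·2((2d+1)L)²a·‖φ(y,κ)‖`; §4 **`norm_segMain_blockDensity_sub_le`**: the displayed structure of `segMain` with the error
`2((2d+1)L)²a·‖φ(y,κ)‖ + (2((2d+1)L)² + 2(2(d+1)L)²)a·‖φ(y+e_κ,κ)‖`.  NE3 ITSELF IS NOT PROVED; nothing of Bałaban's is asserted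
(context: [Balaban1985Averaging] (42) p. 23, (122)∕(125) p. 36).  ABSOLUTE RULE kept: no printed sentence is a hypothesis.
PLACEMENT: `Summits/QuantumFields/BalabanUV/`; imports `AveragingDeficitBlockDensity`, `BlockAverageDbarLinNorms`, `BlockAverageLoopFlux`.
-/

set_option autoImplicit false

open scoped BigOperators Matrix Matrix.Norms.L2Operator
open NormedSpace Finset

namespace Summit.QuantumFields.BalabanUV.T4Continuum.AveragingDeficitBlockDensitySeg

open Literature.MathematicalPhysics.QuantumFieldTheory.Balaban1983to89
open B7Prop1Explicit B7Prop2Explicit MatrixLog UnitaryModel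
open T4AveragingDeficitWall hiding Site Plane Plaq Bond
open T4AveragingDeficitNonAbelian (Ad_mul Ad_sub)
open AveragingDeficitTransport (dhol dhol_nil dhol_cons dstep dhol_append norm_Ad_of_unitary)
open AveragingDeficitNearIdentity (Ad_one norm_Ad_sub_le Ad_real_smul Ad_add Ad_sum)
open SpreadLift (loopRad)
open SpreadLiftWords (perpOff boxVec_perpOff_add cdiv_smul_add_boxVec)
open SkeletonLattice (cdiv cmod cdiv_eq_of_repr)
open BlockAverageDbarLinBound (segMain)
open BlockAverageLoopFlux (sum_boxCoord)
open AveragingDeficitBlockDensity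

noncomputable section

variable {d : ℕ} {n : Type*} [Fintype n] [DecidableEq n]

/-! ## §1 The linearised transport along a positive straight segment, as a sum -/

/-- `(δ_Y U)([p, p + me_κ]) = Σ_{i<m} Ad_{U([p, p+(i+1)e_κ])} Y(p + ie_κ, κ)`. [folklore] -/
theorem dhol_seg_eq_sum (U : Site d → Fin d → (Matrix n n ℂ)ˣ) (Y : Site d → Fin d → Matrix n n ℂ) (κ : Fin d) :
    ∀ (m : ℕ) (p : Site d), dhol U Y p (seg κ m)
      = ∑ i ∈ Finset.range m, Ad (hol U p (seg κ ((i + 1 : ℕ) : ℤ))) (Y (p + (i : ℤ) • e κ) κ)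
  | 0, p => by simp
  | m + 1, p => by
    rw [show ((m + 1 : ℕ) : ℤ) = (m : ℤ) + 1 by push_cast; ring,
      show seg κ ((m : ℤ) + 1) = (κ, true) :: seg κ (m : ℤ) by
        rw [show (m : ℤ) + 1 = ((m + 1 : ℕ) : ℤ) by push_cast; ring, seg_natCast, seg_natCast, List.replicate_succ],
      dhol_cons, Letter.vec_true, stepHol_true, AveragingDeficitTransport.dstep_true, dhol_seg_eq_sum U Y κ m (p + e κ), Ad_sum,
      Finset.sum_range_succ', add_comm]
    congr 1
    · refine Finset.sum_congr rfl fun i _ => ?_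
      rw [← Ad_mul]
      have e1 : U p κ * hol U (p + e κ) (seg κ ((i + 1 : ℕ) : ℤ)) = hol U p (seg κ ((i + 1 + 1 : ℕ) : ℤ)) := by
        simp only [seg_natCast, List.replicate_succ, hol_cons, Letter.vec_true, stepHol_true]
      have e2 : p + e κ + ((i : ℕ) : ℤ) • e κ = p + ((i + 1 : ℕ) : ℤ) • e κ := by push_cast; module
      rw [e1, e2]
    · have e3 : hol U p (seg κ ((0 + 1 : ℕ) : ℤ)) = U p κ := by
        rw [seg_natCast, List.replicate_succ, List.replicate_zero, hol_cons, hol_nil, mul_one, stepHol_true]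
      rw [e3, Nat.cast_zero, zero_smul, add_zero]

omit [Fintype n] [DecidableEq n] in
/-- `|u|₁ ≤ d·L` when `0 ≤ u_i ≤ L`. [folklore] -/
theorem l1_le_of_bounds {L : ℕ} (u : Site d) (h0 : ∀ i, 0 ≤ u i) (h1 : ∀ i, u i ≤ L) : l1 u ≤ d * L := by
  unfold l1
  calc ∑ i, (u i).natAbs ≤ ∑ _i : Fin d, L := Finset.sum_le_sum fun i _ => by
          have := h0 i; have := h1 i; omega
    _ = d * L := by simp

/-! ## §2 The two closed words of the straight segments -/

/-- THE IN-BLOCK SEGMENT LOOP at the corner `q`: `Γ_{q,p} ∪ [p, p+(i+1)e_κ] ∪ −Γ_{q,p+(i+1)e_κ}`. [folklore] -/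
def loopWordC (q p : Site d) (κ : Fin d) (i : ℕ) : List (Letter d) :=
  treeWord (p - q) ++ (seg κ ((i + 1 : ℕ) : ℤ) ++ revWord (treeWord (p + ((i + 1 : ℕ) : ℤ) • e κ - q)))

omit [Fintype n] [DecidableEq n] in
/-- It is closed. [folklore] -/
theorem disp_loopWordC (q p : Site d) (κ : Fin d) (i : ℕ) : disp (loopWordC q p κ i) = 0 := by
  simp only [loopWordC, disp_append, disp_treeWord, disp_seg, disp_revWord]; abel

omit [Fintype n] [DecidableEq n] in
/-- Its length. [folklore] -/
theorem length_loopWordC (q p : Site d) (κ : Fin d) (i : ℕ) :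
    (loopWordC q p κ i).length = l1 (p - q) + (i + 1) + l1 (p + ((i + 1 : ℕ) : ℤ) • e κ - q) := by
  simp only [loopWordC, List.length_append, length_treeWord, length_seg, length_revWord, Int.natAbs_natCast]; ring

/-- **ITS HOLONOMY**: `U(Γ_{q,p})·U([p,p+(i+1)e_κ])·U(Γ_{q,p+(i+1)e_κ})⁻¹`. [folklore] -/
theorem hol_loopWordC (U : Site d → Fin d → (Matrix n n ℂ)ˣ) (q p : Site d) (κ : Fin d) (i : ℕ) :
    hol U q (loopWordC q p κ i)
      = hol U q (treeWord (p - q)) * (hol U p (seg κ ((i + 1 : ℕ) : ℤ)) * (hol U q (treeWord (p + ((i + 1 : ℕ) : ℤ) • e κ - q)))⁻¹) := by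
  rw [loopWordC, hol_append, disp_treeWord, show q + (p - q) = p by abel, hol_append, disp_seg,
    hol_revWord' U (x := q) (p + ((i + 1 : ℕ) : ℤ) • e κ) (treeWord (p + ((i + 1 : ℕ) : ℤ) • e κ - q)) (by rw [disp_treeWord]; abel)]

/-- THE FACE LOOP OF THE SEGMENTS at the corner `q`: `Γ_{q,p} ∪ [p, p+se_κ] ∪ −Γ_{q′,p+se_κ} ∪ −Γ_c`, `q′ = q + Le_κ`. [folklore] -/
def loopWordK (L : ℕ) (q p : Site d) (κ : Fin d) (s : ℕ) : List (Letter d) :=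
  treeWord (p - q) ++ (seg κ (s : ℤ) ++ (revWord (treeWord (p + (s : ℤ) • e κ - (q + (L : ℤ) • e κ))) ++ seg κ (-(L : ℤ))))

omit [Fintype n] [DecidableEq n] in
/-- It is closed. [folklore] -/
theorem disp_loopWordK (L : ℕ) (q p : Site d) (κ : Fin d) (s : ℕ) : disp (loopWordK L q p κ s) = 0 := by
  simp only [loopWordK, disp_append, disp_treeWord, disp_seg, disp_revWord, neg_smul]; abel

omit [Fintype n] [DecidableEq n] in
/-- Its length. [folklore] -/
theorem length_loopWordK (L : ℕ) (q p : Site d) (κ : Fin d) (s : ℕ) :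
    (loopWordK L q p κ s).length = l1 (p - q) + s + l1 (p + (s : ℤ) • e κ - (q + (L : ℤ) • e κ)) + L := by
  simp only [loopWordK, List.length_append, length_treeWord, length_seg, length_revWord, Int.natAbs_natCast, Int.natAbs_neg]
  ring

/-- **ITS HOLONOMY**: `U(Γ_{q,p})·U([p,p+se_κ])·U(Γ_{q′,p+se_κ})⁻¹·U(Γ_c)⁻¹`. [folklore] -/
theorem hol_loopWordK (L : ℕ) (U : Site d → Fin d → (Matrix n n ℂ)ˣ) (q p : Site d) (κ : Fin d) (s : ℕ) :
    hol U q (loopWordK L q p κ s)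
      = hol U q (treeWord (p - q)) * (hol U p (seg κ (s : ℤ))
          * ((hol U (q + (L : ℤ) • e κ) (treeWord (p + (s : ℤ) • e κ - (q + (L : ℤ) • e κ))))⁻¹ * (hol U q (seg κ (L : ℤ)))⁻¹)) := by
  rw [loopWordK, hol_append, disp_treeWord, show q + (p - q) = p by abel, hol_append, disp_seg, hol_append, disp_revWord,
    disp_treeWord, show p + (s : ℤ) • e κ + -(p + (s : ℤ) • e κ - (q + (L : ℤ) • e κ)) = q + (L : ℤ) • e κ by abel,
    hol_revWord' U (x := q + (L : ℤ) • e κ) (p + (s : ℤ) • e κ) (treeWord (p + (s : ℤ) • e κ - (q + (L : ℤ) • e κ)))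
      (by rw [disp_treeWord]; abel),
    show seg κ (-(L : ℤ)) = revWord (seg κ (L : ℤ)) by rw [revWord_seg],
    hol_revWord' U (x := q) (q + (L : ℤ) • e κ) (seg κ (L : ℤ)) (by rw [disp_seg])]

/-! ## §3 A straight run inside one block -/

section Small

variable [Nonempty n] {L : ℕ} (hL : 1 ≤ L) {U : Site d → Fin d → (Matrix n n ℂ)ˣ} (hU : IsUnitaryCfg U) {a : ℝ} (ha : 0 ≤ a)
  (hUa : SmallField U a)

include hL hU ha hUa

/-- **A STRAIGHT RUN INSIDE THE BLOCK OF `y`**: from `p = Ly + u` (`0 ≤ u`, `u_i < L` for `i ≠ κ`, `u_κ + m ≤ L`),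
`‖Ad_{U(Γ_{Ly,p})}(δ_{S₀φ}U)([p, p+me_κ]) − (m/L)·Ad_{U(Γ_c)}φ(y,κ)‖ ≤ (m/L)·2((2d+1)L)²a·‖φ(y,κ)‖`. [folklore] -/
theorem norm_seg_blockDensity_sub_le (φ : Site d → Fin d → Matrix n n ℂ) (y : Site d) (κ : Fin d) (m : ℕ) (u : Site d)
    (hnn : ∀ i, 0 ≤ u i) (hlt : ∀ i, i ≠ κ → u i < L) (hm : u κ + m ≤ L) :
    ‖Ad (btree L U y ((L : ℤ) • y + u)) (dhol U (blockDensity L U φ) ((L : ℤ) • y + u) (seg κ m))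
        - ((m : ℝ) / L) • Ad (bseg L U y κ) (φ y κ)‖
      ≤ (m : ℝ) / L * (2 * (((2 * d + 1) * L : ℝ) ^ 2 * a)) * ‖φ y κ‖ := by
  set q : Site d := (L : ℤ) • y with hq
  set p : Site d := q + u with hp
  set X : Matrix n n ℂ := Ad (bseg L U y κ) (φ y κ) with hX
  have hXn : ‖X‖ = ‖φ y κ‖ := norm_Ad_of_unitary (bseg_mem hU L y κ) _
  -- the bonds of the run lie in the block of `y`
  have hcd : ∀ i ∈ Finset.range m, cdiv L (p + (i : ℤ) • e κ) = y := by
    intro i hi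
    rw [Finset.mem_range] at hi
    refine cdiv_eq_of_repr (L := L) (q := u + (i : ℤ) • e κ) (by rw [hp, hq]; abel) (fun j => ?_) (fun j => ?_)
    · simp only [Pi.add_apply, Pi.smul_apply, e_apply, smul_eq_mul, mul_ite, mul_one, mul_zero]
      split_ifs <;> linarith [hnn j]
    · simp only [Pi.add_apply, Pi.smul_apply, e_apply, smul_eq_mul, mul_ite, mul_one, mul_zero]
      split_ifs with h
      · subst h; omega
      · rw [add_zero]; exact hlt j h
  -- the run as a sum of transported loop holonomies acting on `X`
  have hsum : Ad (btree L U y p) (dhol U (blockDensity L U φ) p (seg κ m))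
      = ∑ i ∈ Finset.range m, ((L : ℝ)⁻¹) • Ad (hol U q (loopWordC q p κ i)) X := by
    rw [dhol_seg_eq_sum, Ad_sum]
    refine Finset.sum_congr rfl fun i hi => ?_
    rw [blockDensity_apply, hcd i hi, Ad_real_smul, Ad_real_smul, ← Ad_mul, ← Ad_mul, hol_loopWordC, hX, ← Ad_mul]
    have e1 : p + (i : ℤ) • e κ + e κ = p + ((i + 1 : ℕ) : ℤ) • e κ := by push_cast; module
    have e2 : btree L U y (p + (i : ℤ) • e κ + e κ) = hol U q (treeWord (p + ((i + 1 : ℕ) : ℤ) • e κ - q)) := by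
      rw [e1]; rfl
    rw [e2, show btree L U y p = hol U q (treeWord (p - q)) from rfl]
    simp only [mul_assoc]
  -- `(m/L)·X` as the same sum with trivial transports
  have hconst : ((m : ℝ) / L) • X = ∑ _i ∈ Finset.range m, ((L : ℝ)⁻¹) • X := by
    rw [Finset.sum_const, Finset.card_range, ← Nat.cast_smul_eq_nsmul ℝ, smul_smul, div_eq_mul_inv]
  rw [hsum, hconst, ← Finset.sum_sub_distrib]
  -- termwise loop bound
  have hterm : ∀ i ∈ Finset.range m, ‖((L : ℝ)⁻¹) • Ad (hol U q (loopWordC q p κ i)) X - ((L : ℝ)⁻¹) • X‖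
      ≤ (L : ℝ)⁻¹ * (2 * (((2 * d + 1) * L : ℝ) ^ 2 * a) * ‖φ y κ‖) := by
    intro i hi
    rw [Finset.mem_range] at hi
    rw [← smul_sub, norm_smul, norm_inv, Real.norm_natCast]
    refine mul_le_mul_of_nonneg_left ?_ (by positivity)
    have hloop := norm_hol_closed_sub_one_le hU ha hUa q (loopWordC q p κ i) (disp_loopWordC q p κ i)
    have hlen : (loopWordC q p κ i).length ≤ (2 * d + 1) * L := by
      rw [length_loopWordC, hp, add_sub_cancel_left, show q + u + (((i + 1 : ℕ)) : ℤ) • e κ - q = u + ((i + 1 : ℕ) : ℤ) • e κ by abel]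
      have h1 : l1 u ≤ d * L := l1_le_of_bounds u hnn fun j => by
        by_cases h : j = κ
        · subst h; omega
        · exact (hlt j h).le
      have h2 : l1 (u + ((i + 1 : ℕ) : ℤ) • e κ) ≤ d * L := l1_le_of_bounds _ (fun j => by
          simp only [Pi.add_apply, Pi.smul_apply, e_apply, smul_eq_mul, mul_ite, mul_one, mul_zero]
          split_ifs <;> push_cast <;> linarith [hnn j]) (fun j => by
          simp only [Pi.add_apply, Pi.smul_apply, e_apply, smul_eq_mul, mul_ite, mul_one, mul_zero]
          split_ifs with h
          · subst h; push_cast; omega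
          · rw [add_zero]; exact (hlt j h).le)
      have h3 : (2 * d + 1) * L = d * L + L + d * L := by ring
      have h4 := hnn κ
      omega
    have hlen' : ((loopWordC q p κ i).length : ℝ) ≤ (2 * d + 1) * L := by exact_mod_cast hlen
    have hW : ‖((hol U q (loopWordC q p κ i) : (Matrix n n ℂ)ˣ) : Matrix n n ℂ) - 1‖ ≤ ((2 * d + 1) * L : ℝ) ^ 2 * a :=
      hloop.trans (mul_le_mul_of_nonneg_right (pow_le_pow_left₀ (Nat.cast_nonneg _) hlen' 2) ha)
    rw [← hXn]
    exact (norm_Ad_sub_le (hol_mem_of hU _ _) X).trans (by gcongr)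
  refine (norm_sum_le _ _).trans ((Finset.sum_le_sum hterm).trans (le_of_eq ?_))
  rw [Finset.sum_const, Finset.card_range, nsmul_eq_mul]
  ring

/-! ## §4 The structure of `segMain` on the block density -/

/-- ONE BLOCK POINT `x = Ly + r`: the transported straight segment from `x` is `((L − r_κ)/L)·X + (r_κ/L)·Ad_{U(Γ_c)} X′` up to
`cC·‖φ(y,κ)‖ + (cC + cK)·‖φ(y+e_κ,κ)‖` (`X = Ad_{U(Γ_c)}φ(y,κ)`, `X′ = Ad_{U(Γ_{c′})}φ(y+e_κ,κ)`, `cC = 2((2d+1)L)²a`, `cK = 2(2(d+1)L)²a`).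
[folklore] -/
theorem norm_segRun_blockDensity_sub_le (φ : Site d → Fin d → Matrix n n ℂ) (y : Site d) (κ : Fin d) (r : Fin d → Fin L) :
    ‖Ad (hol U ((L : ℤ) • y) (treeWord (boxVec L r)))
          (dhol U (blockDensity L U φ) ((L : ℤ) • y + boxVec L r) (seg κ L))
        - (((((L - (r κ : ℕ) : ℕ) : ℝ)) / L) • Ad (bseg L U y κ) (φ y κ)
            + ((((r κ : ℕ) : ℝ)) / L) • Ad (bseg L U y κ) (Ad (bseg L U (y + e κ) κ) (φ (y + e κ) κ)))‖
      ≤ 2 * (((2 * d + 1) * L : ℝ) ^ 2 * a) * ‖φ y κ‖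
        + (2 * (((2 * d + 1) * L : ℝ) ^ 2 * a) + 2 * ((2 * (d + 1) * L : ℝ) ^ 2 * a)) * ‖φ (y + e κ) κ‖ := by
  set q : Site d := (L : ℤ) • y with hq
  set y' : Site d := y + e κ with hy'
  set X : Matrix n n ℂ := Ad (bseg L U y κ) (φ y κ) with hX
  set X' : Matrix n n ℂ := Ad (bseg L U y' κ) (φ y' κ) with hX'
  set cC : ℝ := 2 * (((2 * d + 1) * L : ℝ) ^ 2 * a) with hcC
  set cK : ℝ := 2 * ((2 * (d + 1) * L : ℝ) ^ 2 * a) with hcK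
  have hXn : ‖X‖ = ‖φ y κ‖ := norm_Ad_of_unitary (bseg_mem hU L y κ) _
  have hX'n : ‖X'‖ = ‖φ y' κ‖ := norm_Ad_of_unitary (bseg_mem hU L y' κ) _
  have hcC0 : 0 ≤ cC := by positivity
  have hcK0 : 0 ≤ cK := by positivity
  set u : Site d := boxVec L r with hu
  set ρ : ℕ := (r κ : ℕ) with hρ
  set s : ℕ := L - ρ with hs
  have hρL : ρ < L := (r κ).isLt
  have hsρ : s + ρ = L := by omega
  set p' : Site d := q + u + (s : ℤ) • e κ with hp'
  -- `p′ = q′ + u⊥`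
  have hp'eq : p' = (L : ℤ) • y' + boxVec L (perpOff hL κ r) := by
    rw [hp', hy', smul_add, hu, ← boxVec_perpOff_add hL κ r, hs, Nat.cast_sub hρL.le]
    simp only [sub_smul]
    abel
  -- split the segment
  have hsegsplit : seg κ (L : ℤ) = seg κ (s : ℤ) ++ seg κ (ρ : ℤ) := by
    rw [show (L : ℤ) = ((s + ρ : ℕ) : ℤ) by rw [hsρ], seg_natCast, seg_natCast, seg_natCast, List.replicate_add]
  have hbt : hol U q (treeWord (boxVec L r)) = btree L U y (q + u) := by
    simp only [btree, hq, hu, add_sub_cancel_left]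
  rw [hsegsplit, dhol_append, disp_seg, Ad_add, hbt]
  -- run 1, inside the block of `y`
  have h1 := norm_seg_blockDensity_sub_le hL hU ha hUa φ y κ s u (fun i => by simp [hu, boxVec])
    (fun i _ => by simp only [hu, boxVec]; exact_mod_cast (r i).isLt) (by simp only [hu, boxVec, ← hρ]; omega)
  -- run 2, inside the block of `y′`, read from `p′ = q′ + u⊥`
  have h2 := norm_seg_blockDensity_sub_le hL hU ha hUa φ y' κ ρ (boxVec L (perpOff hL κ r))
    (fun i => by simp [boxVec]) (fun i hi => by simp only [boxVec, perpOff, if_neg hi]; exact_mod_cast (r i).isLt)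
    (by simp only [boxVec, perpOff, if_true, Nat.cast_zero, zero_add]; exact_mod_cast hρL.le)
  rw [← hp'eq] at h2
  -- the prefactor of run 2: `btree y (q+u) · U([q+u, p′]) = K · bseg y κ · btree y′ p′`
  set K : (Matrix n n ℂ)ˣ := hol U q (loopWordK L q (q + u) κ s) with hK
  have hKeq : btree L U y (q + u) * hol U (q + u) (seg κ (s : ℤ)) = K * (bseg L U y κ * btree L U y' p') := by
    have e1 : btree L U y' p' = hol U (q + (L : ℤ) • e κ) (treeWord (q + u + (s : ℤ) • e κ - (q + (L : ℤ) • e κ))) := by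
      simp only [btree, hy', hp', hq, smul_add]
    have e2 : btree L U y (q + u) = hol U q (treeWord (q + u - q)) := rfl
    have e3 : bseg L U y κ = hol U q (seg κ (L : ℤ)) := rfl
    rw [hK, hol_loopWordK, e1, e2, e3]
    simp only [mul_assoc, inv_mul_cancel_left, inv_mul_cancel, mul_one]
  have hKu : K ∈ unitaryUnits (Matrix n n ℂ) := hol_mem_of hU _ _
  have hKn : ‖(K : Matrix n n ℂ) - 1‖ ≤ (2 * (d + 1) * L : ℝ) ^ 2 * a := by
    have hloop := norm_hol_closed_sub_one_le hU ha hUa q (loopWordK L q (q + u) κ s) (disp_loopWordK L q (q + u) κ s)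
    have hlen : (loopWordK L q (q + u) κ s).length ≤ 2 * (d + 1) * L := by
      have e4 : q + u + (s : ℤ) • e κ - (q + (L : ℤ) • e κ) = boxVec L (perpOff hL κ r) := by
        rw [show q + u + (s : ℤ) • e κ = p' from rfl, hp'eq, hy', smul_add, hq]; abel
      rw [length_loopWordK, add_sub_cancel_left, e4]
      have hl1 := l1_boxVec_le L r
      have hl2 := l1_boxVec_le L (perpOff hL κ r)
      rw [← hu] at hl1
      have : 2 * (d + 1) * L = d * L + L + d * L + L := by ring
      omega
    have hlen' : ((loopWordK L q (q + u) κ s).length : ℝ) ≤ 2 * (d + 1) * L := by exact_mod_cast hlen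
    exact hloop.trans (mul_le_mul_of_nonneg_right (pow_le_pow_left₀ (Nat.cast_nonneg _) hlen' 2) ha)
  -- the second run
  have hrun2 : ‖Ad (btree L U y (q + u)) (Ad (hol U (q + u) (seg κ (s : ℤ)))
          (dhol U (blockDensity L U φ) (q + u + (s : ℤ) • e κ) (seg κ (ρ : ℤ))))
        - (((ρ : ℕ) : ℝ) / L) • Ad (bseg L U y κ) X'‖ ≤ (cC + cK) * ‖φ y' κ‖ := by
    rw [← Ad_mul, hKeq, Ad_mul, Ad_mul]
    set D := Ad (btree L U y' p') (dhol U (blockDensity L U φ) p' (seg κ (ρ : ℤ))) with hD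
    have hDn : ‖D - ((ρ : ℝ) / L) • X'‖ ≤ (ρ : ℝ) / L * cC * ‖φ y' κ‖ := by rw [hD, hX', hcC]; exact h2
    have hρ1 : (ρ : ℝ) / L ≤ 1 := by rw [div_le_one (by exact_mod_cast (by omega : 0 < L))]; exact_mod_cast hρL.le
    have hX's : ‖((ρ : ℝ) / L) • X'‖ ≤ ‖φ y' κ‖ := by
      rw [norm_smul, Real.norm_of_nonneg (by positivity), hX'n]; exact mul_le_of_le_one_left (norm_nonneg _) hρ1
    have e1 : Ad K (Ad (bseg L U y κ) D) - ((ρ : ℝ) / L) • Ad (bseg L U y κ) X'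
        = Ad K (Ad (bseg L U y κ) (D - ((ρ : ℝ) / L) • X'))
          + (Ad K (Ad (bseg L U y κ) (((ρ : ℝ) / L) • X')) - Ad (bseg L U y κ) (((ρ : ℝ) / L) • X')) := by
      rw [Ad_sub, Ad_sub, Ad_real_smul, Ad_real_smul]; abel
    rw [e1]
    refine (norm_add_le _ _).trans ?_
    rw [norm_Ad_of_unitary hKu, norm_Ad_of_unitary (bseg_mem hU L y κ)]
    have t2 := norm_Ad_sub_le hKu (Ad (bseg L U y κ) (((ρ : ℝ) / L) • X'))
    rw [norm_Ad_of_unitary (bseg_mem hU L y κ)] at t2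
    have t2' : ‖Ad K (Ad (bseg L U y κ) (((ρ : ℝ) / L) • X')) - Ad (bseg L U y κ) (((ρ : ℝ) / L) • X')‖ ≤ cK * ‖φ y' κ‖ := by
      refine t2.trans ?_
      rw [hcK]
      calc 2 * ‖(K : Matrix n n ℂ) - 1‖ * ‖((ρ : ℝ) / L) • X'‖ ≤ 2 * ((2 * (d + 1) * L : ℝ) ^ 2 * a) * ‖φ y' κ‖ := by
            gcongr
        _ = _ := by ring
    have t1' : ‖D - ((ρ : ℝ) / L) • X'‖ ≤ cC * ‖φ y' κ‖ := by
      refine hDn.trans ?_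
      rw [mul_assoc]
      exact mul_le_of_le_one_left (mul_nonneg hcC0 (norm_nonneg _)) hρ1
    linarith
  -- the first run
  have hrun1 : ‖Ad (btree L U y (q + u)) (dhol U (blockDensity L U φ) (q + u) (seg κ (s : ℤ))) - ((s : ℝ) / L) • X‖
      ≤ cC * ‖φ y κ‖ := by
    have hs1 : (s : ℝ) / L ≤ 1 := by rw [div_le_one (by exact_mod_cast (by omega : 0 < L))]; exact_mod_cast (by omega : s ≤ L)
    refine h1.trans ?_
    rw [← hcC, mul_assoc]
    exact mul_le_of_le_one_left (mul_nonneg hcC0 (norm_nonneg _)) hs1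
  have hsL : (((L - ρ : ℕ) : ℝ)) = (s : ℝ) := by rw [hs]
  rw [hsL]
  set A : Matrix n n ℂ := Ad (btree L U y (q + u)) (dhol U (blockDensity L U φ) (q + u) (seg κ (s : ℤ))) with hA
  set Bt : Matrix n n ℂ := Ad (btree L U y (q + u)) (Ad (hol U (q + u) (seg κ (s : ℤ)))
    (dhol U (blockDensity L U φ) p' (seg κ (ρ : ℤ)))) with hBt
  rw [show A + Bt - (((s : ℝ) / L) • X + ((((ρ : ℕ) : ℝ)) / L) • Ad (bseg L U y κ) X')
      = (A - ((s : ℝ) / L) • X) + (Bt - ((((ρ : ℕ) : ℝ)) / L) • Ad (bseg L U y κ) X') by abel]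
  exact (norm_add_le _ _).trans (add_le_add hrun1 hrun2)

omit [Nonempty n] hU ha hUa in
/-- The two first moments of the block average: `Σ_r L^{−d}(L − r_κ)/L = (L+1)/2L`. [folklore] -/
theorem avg_weight_left (κ : Fin d) :
    ∑ r : Fin d → Fin L, ((L : ℝ) ^ d)⁻¹ * ((((L - (r κ : ℕ) : ℕ) : ℝ)) / L) = ((L : ℝ) + 1) / (2 * L) := by
  have hL0 : (L : ℝ) ≠ 0 := by exact_mod_cast (by omega : L ≠ 0)
  have hLd : ((L : ℝ) ^ d) ≠ 0 := pow_ne_zero _ hL0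
  have hS : ∑ r : Fin d → Fin L, ((L : ℝ) - ((r κ : ℕ) : ℝ)) = (L : ℝ) ^ d * L - (L : ℝ) ^ d * (((L : ℝ) - 1) / 2) := by
    rw [Finset.sum_sub_distrib, sum_boxCoord, Finset.sum_const, Finset.card_univ, Fintype.card_fun, Fintype.card_fin,
      Fintype.card_fin, nsmul_eq_mul, Nat.cast_pow]
  have e : ∀ r : Fin d → Fin L, (((L - (r κ : ℕ) : ℕ) : ℝ)) = (L : ℝ) - ((r κ : ℕ) : ℝ) := fun r => by
    rw [Nat.cast_sub (r κ).isLt.le]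
  calc ∑ r : Fin d → Fin L, ((L : ℝ) ^ d)⁻¹ * ((((L - (r κ : ℕ) : ℕ) : ℝ)) / L)
      = ((L : ℝ) ^ d)⁻¹ / L * ∑ r : Fin d → Fin L, ((L : ℝ) - ((r κ : ℕ) : ℝ)) := by
        rw [Finset.mul_sum]; exact Finset.sum_congr rfl fun r _ => by rw [e r]; ring
    _ = ((L : ℝ) + 1) / (2 * L) := by rw [hS]; field_simp; ring

omit [Nonempty n] hU ha hUa in
/-- … and `Σ_r L^{−d} r_κ/L = (L−1)/2L`. [folklore] -/
theorem avg_weight_right (κ : Fin d) :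
    ∑ r : Fin d → Fin L, ((L : ℝ) ^ d)⁻¹ * ((((r κ : ℕ) : ℝ)) / L) = ((L : ℝ) - 1) / (2 * L) := by
  have hL0 : (L : ℝ) ≠ 0 := by exact_mod_cast (by omega : L ≠ 0)
  have hLd : ((L : ℝ) ^ d) ≠ 0 := pow_ne_zero _ hL0
  calc ∑ r : Fin d → Fin L, ((L : ℝ) ^ d)⁻¹ * ((((r κ : ℕ) : ℝ)) / L)
      = ((L : ℝ) ^ d)⁻¹ / L * ∑ r : Fin d → Fin L, (((r κ : ℕ) : ℝ)) := by
        rw [Finset.mul_sum]; exact Finset.sum_congr rfl fun r _ => by ring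
    _ = ((L : ℝ) - 1) / (2 * L) := by rw [sum_boxCoord]; field_simp

/-- **`segMain L U (S₀φ) (L•y) κ = ((L+1)/2L)·Ad_{U(Γ_c)}φ(y,κ) + ((L−1)/2L)·Ad_{U(Γ_c)U(Γ_{c′})}φ(y+e_κ,κ) + E`** with
`‖E‖ ≤ 2((2d+1)L)²a·‖φ(y,κ)‖ + (2((2d+1)L)² + 2(2(d+1)L)²)a·‖φ(y+e_κ,κ)‖`. [cite: Balaban1985Averaging, (125) p.36] -/
theorem norm_segMain_blockDensity_sub_le (φ : Site d → Fin d → Matrix n n ℂ) (y : Site d) (κ : Fin d) :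
    ‖segMain L U (blockDensity L U φ) ((L : ℤ) • y) κ
        - ((((L : ℝ) + 1) / (2 * L)) • Ad (bseg L U y κ) (φ y κ)
            + (((L : ℝ) - 1) / (2 * L)) • Ad (bseg L U y κ * bseg L U (y + e κ) κ) (φ (y + e κ) κ))‖
      ≤ 2 * (((2 * d + 1) * L : ℝ) ^ 2 * a) * ‖φ y κ‖
        + (2 * (((2 * d + 1) * L : ℝ) ^ 2 * a) + 2 * ((2 * (d + 1) * L : ℝ) ^ 2 * a)) * ‖φ (y + e κ) κ‖ := by
  set X : Matrix n n ℂ := Ad (bseg L U y κ) (φ y κ) with hX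
  set Z : Matrix n n ℂ := Ad (bseg L U y κ * bseg L U (y + e κ) κ) (φ (y + e κ) κ) with hZ
  set B : ℝ := 2 * (((2 * d + 1) * L : ℝ) ^ 2 * a) * ‖φ y κ‖
        + (2 * (((2 * d + 1) * L : ℝ) ^ 2 * a) + 2 * ((2 * (d + 1) * L : ℝ) ^ 2 * a)) * ‖φ (y + e κ) κ‖ with hB
  -- the main term as a block average
  have hmain : (((L : ℝ) + 1) / (2 * L)) • X + (((L : ℝ) - 1) / (2 * L)) • Z
      = ∑ r : Fin d → Fin L, (((L : ℝ) ^ d)⁻¹) •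
          (((((L - (r κ : ℕ) : ℕ) : ℝ)) / L) • X + ((((r κ : ℕ) : ℝ)) / L) • Z) := by
    rw [← avg_weight_left (d := d) hL κ, ← avg_weight_right (d := d) hL κ, Finset.sum_smul, Finset.sum_smul,
      ← Finset.sum_add_distrib]
    refine Finset.sum_congr rfl fun r _ => ?_
    rw [smul_add, smul_smul, smul_smul]
  -- termwise
  have hpt : ∀ r : Fin d → Fin L,
      ‖(((L : ℝ) ^ d)⁻¹) • Ad (hol U ((L : ℤ) • y) (treeWord (boxVec L r)))
            (dhol U (blockDensity L U φ) ((L : ℤ) • y + boxVec L r) (seg κ L))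
          - (((L : ℝ) ^ d)⁻¹) • (((((L - (r κ : ℕ) : ℕ) : ℝ)) / L) • X + ((((r κ : ℕ) : ℝ)) / L) • Z)‖
        ≤ ((L : ℝ) ^ d)⁻¹ * B := by
    intro r
    rw [← smul_sub, norm_smul, norm_inv, norm_pow, Real.norm_natCast]
    refine mul_le_mul_of_nonneg_left ?_ (by positivity)
    have h := norm_segRun_blockDensity_sub_le hL hU ha hUa φ y κ r
    rw [← Ad_mul] at h
    exact h
  unfold segMain
  rw [hmain, ← Finset.sum_sub_distrib]
  refine (norm_sum_le _ _).trans ((Finset.sum_le_sum fun r _ => hpt r).trans (le_of_eq ?_))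
  rw [← Finset.sum_mul, BlockAveragePushDirSplit.sum_blockWeight_eq_one L hL, one_mul]

end Small

end

end Summit.QuantumFields.BalabanUV.T4Continuum.AveragingDeficitBlockDensitySeg
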